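import Summits.HodgeConjecture.HodgeConjecture.Theorems.F0P2oD7alphaMemOfT5               -- ★ p839806 (F0P2-p01 (g9)): kit-generic MEM for every `ξ`
import Summits.HodgeConjecture.HodgeConjecture.Theorems.F0P3KitOfRecordLawsV8               -- ★ K-side V8: `laws₈_kitOfRecord_of₄`, `routing₈_kitOfRecord_of_v6`, `lawsV8_kitFamilyOfRecord_of`, `SpecPkg`, `FactorisationCls`
import Summits.HodgeConjecture.HodgeConjecture.Theorems.F0P2oCharIdentityCompletionUnique   -- ★ p839791 (F0P2-p02 (g8)): (D-a) junction `cmThetaDockingClauses_of_thetaWitness`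
import Summits.HodgeConjecture.HodgeConjecture.Theorems.F0P2oD7alphaMemDockStatement      -- (F0P2-p01 (g9), STEP 1): the per-measure node `StubD7αMemDockPerMeasure` (statement only)
import Literature.NumberTheory.GelbartRogawski1991.PiSCompletionIsThetaType               -- ★ p839836 (B-p18 (g29)): the print letter (D-b) `piSCompletion_isThetaTypeAtCM`
import HarnessLib

/-!
# Crux `H413`, programme P2 — (D7α-J) shape (S1): PKΠ's `StubD7αMemDock` AT THE ROWS OF A KIT FAMILY OF RECORD
# (MEM from the fourteen rows; DOCK from the theta witness + surjective matching; Lines-free, assembly only)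

Cell `hodgecm-mathlib` (D-0151), FLOOR 0, crux item H413 = `stmt-HodgeConjecture-24833`, route of record `HCCMUnconditional`; programme P2, fallback road PKΠ
`Cruxes/H413/Lines/F0_P2PKPiRung4.lean` v1.13 (commit 5db8a2fd3614), engine stub `stub_D7αMemDock : StubD7αMemDock`.  F0P2-p01 (g9) (owner) ∕ F0P2-p02 (g8) (co-pen),
desk F0P2-plan (g9) DEAL (D7α-J) 2026-09-01T01:44:33Z; SPEC `F0/P2/p01/g9/SPEC-D7alpha-of-letters.md` (7018008cb4df3907) §0 shape (S1).
Helper file: THEOREMS ONLY (no definition, no named fact, no instance declaration or attribute, no notation, no `sorry`); `--supports stmt-HodgeConjecture-24833 --as helper`.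
HONEST LABEL: HC_CM is proved only modulo the printed citations until rung 0 closes; this file discharges none of them — its hypotheses are the closer's fourteen ROWS at
a `FrameData` family (the data T1's engine produces) and the print letter (D-b); it is instantiated only where the rung-0 choice is in scope (the closer's §D).

WHY «OF ROWS» AND NOT «OF LETTERS» (SPEC §0).  The ∃-data of `StubD7αMemDock` — `(Δ, m_H, m_G)` and the character-identity package `hCM` — are OUTPUTS OF THE T1 ENGINE
(`F0T1InnerFormTraceIdentity.anchoredKit_nonempty_of_stubsQ`, a `Cruxes/H413/Lines/` module); no Lines-free file maps the closer's letters to them.  What IS Lines-free is the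
K-side: ★ `F0P3KitOfRecord.kitFamilyOfRecord 𝔇` for a family `𝔇` of per-frame `FrameData`, its v8 laws from the FOURTEEN ROWS (the hypothesis `h` of ★ `letters_of_specPkgV8`,
VERBATIM below), and ★ p839806's kit-generic MEM.  Hence this file proves, for ANY `𝔇` with the rows:

* §1 `lawsV8_kitFamilyOfRecord_of_rows 𝔇 h : KitFamily.Laws (kitFamilyOfRecord 𝔇)` — the `Laws` extraction of ★ `letters_of_specPkgV8` (its proof :258–:265, re-keyed to the
  family-level `Laws` instead of the letters), and `mem_packFin_of_rows 𝔇 h` — ★ `mem_packFin_of_memXiFamily_of_T5` at `(kitFamilyOfRecord 𝔇, isPinned_kitFamilyOfRecord 𝔇, §1)`: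
  for every cotangent `P` with an irreducible smooth finite component `σ`, EVERY `ξ` with `MemXiFamily P … ξ`, every finite `v` and every class `c` occurring in `σ_v`,
  `c ∈ ((kitFamilyOfRecord 𝔇 …).packFin ξ v).members` — i.e. `c ∈ ((𝔇 …).ξd.packFin ξ v).members` (`rfl`); at the closer's `𝔇₀ = frameDataOfRung0` this is
  `c ∈ (xiPacketFamilyOfRecord L H hH hHd μω hμu Δ mH mG νG νH (fun ξ v => ξ.xiLocalChar v) μZ keys hCM ξ v).members` at the record data (★ `F0P3XiSideOfRecord.xiSideOfRecord_packFin`).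

References: [Rogawski1990] §13.1 p. 199; Prop. 13.1.3 (d), Prop. 13.1.4; Thm. 13.3.7; §13.3 p. 201; §14.6 Thm. 14.6.4 pp. 244–246; §15.3 ¶1.
[GelbartRogawski1991] Lem. 5.1.2 p. 466; Thm. 5.1.1 p. 465.  [Zelevinsky1980] Thm. 4.2.  [BorelWallach2000] VI Thm. 4.11.
-/

set_option autoImplicit false
-- the mandated namespace repeats `HodgeConjecture.HodgeConjecture`, as in every `Theorems/*.lean` of this sub-problem
set_option linter.dupNamespace false

noncomputable section

open NumberField IsDedekindDomain MeasureTheory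
open scoped Matrix ComplexOrder

namespace Summit.HodgeConjecture.HodgeConjecture.Cruxes.H413.F0P2oD7alphaMemDockOfRows

open Literature.NumberTheory.Rogawski1990 Literature.NumberTheory.GaloisRepresentations
open Literature.NumberTheory.Automorphic Literature.NumberTheory.Automorphic.UnitaryGroup
open Literature.NumberTheory.Automorphic.UnitaryGroup.CotangentForms
open Literature.RepresentationTheory.BorelWallach2000 Literature.RepresentationTheory.KonnoKonno2007
open Summit.HodgeConjecture.HodgeConjecture.Cruxes.H413.F0P3InnerFormClassificationV6 (Gp Places)
open Summit.HodgeConjecture.HodgeConjecture.Cruxes.H413.F0P3KitOfRecord (FrameData kitFamilyOfRecord isPinned_kitFamilyOfRecord laws₈_kitOfRecord_of₄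
  routing₈_kitOfRecord_of_v6 lawsV8_kitFamilyOfRecord_of)
open Summit.HodgeConjecture.HodgeConjecture.Cruxes.H413.F0P3XiArchPacketOfRecord (JInfNoDegOne DsInfNoDegOne)

/-! ## §1 The v8 laws of a kit family of record from its fourteen rows, and MEM at the rows -/

section Rows

variable
  (𝔇 : ∀ (L : Type) [Field L] [NumberField L] [IsCMField L] (ι : L →+* ℂ) (H : Matrix (Fin 3) (Fin 3) L) (T : GL (Fin 3) ℂ)
    (hT : (T : Matrix (Fin 3) (Fin 3) ℂ)ᴴ * H.map ι * (T : Matrix (Fin 3) (Fin 3) ℂ) = Literature.Geometry.ComplexHyperbolic.BallModel.J),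
    (∀ τ' : L →+* ℂ, InfinitePlace.mk τ' ≠ InfinitePlace.mk ι → (H.map τ').PosDef) →
    2 ≤ Module.finrank ℚ ↥(maximalRealSubfield L) →
    ∀ (μ : Measure (Gp L H).automorphicQuotient) [(Gp L H).IsAutomorphicMeasure μ] (μω : HeckeCharacter L) (_hμu : μω.IsUnitary),
    (∀ x : Literature.NumberTheory.GaloisRepresentations.ideleGroup ↥(maximalRealSubfield L),
      μω (AdeleRing.ideleBaseChange (↥(maximalRealSubfield L)) L x) = quadraticHeckeCharCM L x) → FrameData L H ι T hT μ)
  (h : ∀ (L : Type) [Field L] [NumberField L] [IsCMField L] (ι : L →+* ℂ) (H : Matrix (Fin 3) (Fin 3) L) (T : GL (Fin 3) ℂ)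
    (hT : (T : Matrix (Fin 3) (Fin 3) ℂ)ᴴ * H.map ι * (T : Matrix (Fin 3) (Fin 3) ℂ) = Literature.Geometry.ComplexHyperbolic.BallModel.J)
    (hdef : ∀ τ' : L →+* ℂ, InfinitePlace.mk τ' ≠ InfinitePlace.mk ι → (H.map τ').PosDef) (h2 : 2 ≤ Module.finrank ℚ ↥(maximalRealSubfield L))
    (μ : Measure (Gp L H).automorphicQuotient) [(Gp L H).IsAutomorphicMeasure μ] (μω : HeckeCharacter L) (hμu : μω.IsUnitary)
    (hμω : ∀ x : Literature.NumberTheory.GaloisRepresentations.ideleGroup ↥(maximalRealSubfield L),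
      μω (AdeleRing.ideleBaseChange (↥(maximalRealSubfield L)) L x) = quadraticHeckeCharCM L x),
    ∃ S₀ : Finset (Places L),
    F0P3InnerFormClassificationV8.ClassificationKit.SpecPkg (kitFamilyOfRecord 𝔇 L ι H T hT hdef h2 μ μω hμu hμω) S₀ ∧
    (kitFamilyOfRecord 𝔇 L ι H T hT hdef h2 μ μω hμu hμω).TraceIdentity ∧
    F0P3InnerFormClassificationV8.ClassificationKit.FactorisationCls (kitFamilyOfRecord 𝔇 L ι H T hT hdef h2 μ μω hμu hμω) S₀ ∧
    (kitFamilyOfRecord 𝔇 L ι H T hT hdef h2 μ μω hμu hμω).SpectralSideGp ∧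
    F0P3InnerFormClassificationV8.ClassificationKit.HatBounded (kitFamilyOfRecord 𝔇 L ι H T hT hdef h2 μ μω hμu hμω) S₀ ∧
    F0P3InnerFormClassificationV8.ClassificationKit.UnrStarAlgebra (kitFamilyOfRecord 𝔇 L ι H T hT hdef h2 μ μω hμu hμω) S₀ ∧
    (kitFamilyOfRecord 𝔇 L ι H T hT hdef h2 μ μω hμu hμω).LinIndepS ∧
    F0P3InnerFormClassificationV8.ClassificationKit.UnitaryPacket (kitFamilyOfRecord 𝔇 L ι H T hT hdef h2 μ μω hμu hμω) S₀ ∧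
    (kitFamilyOfRecord 𝔇 L ι H T hT hdef h2 μ μω hμu hμω).Routing ∧
    JInfNoDegOne (𝔇 L ι H T hT hdef h2 μ μω hμu hμω).jInf ∧ DsInfNoDegOne (𝔇 L ι H T hT hdef h2 μ μω hμu hμω).dsInf ∧
    (kitFamilyOfRecord 𝔇 L ι H T hT hdef h2 μ μω hμu hμω).XiFamilyFin μω hμu ∧
    (kitFamilyOfRecord 𝔇 L ι H T hT hdef h2 μ μω hμu hμω).XiUnram ∧
    (kitFamilyOfRecord 𝔇 L ι H T hT hdef h2 μ μω hμu hμω).EvpConvention)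

include h in
/-- **The v8 LAWS of a kit family of record from its FOURTEEN ROWS** — the `Laws` extraction inside ★ `F0P3KitOfRecord.letters_of_specPkgV8` (its proof, re-keyed to
conclude the family-level `KitFamily.Laws` through ★ `lawsV8_kitFamilyOfRecord_of` instead of the HJ3a letters): ★ `laws₈_kitOfRecord_of₄` at every frame, fed the witnessed
package `SpecPkg` and the named rows (factorisation from its class and packet conjuncts, routing from the v6 text). [cite: Rogawski1990, §14.6 Thm. 14.6.4 pp. 236–244; §15.3 ¶1] -/
theorem lawsV8_kitFamilyOfRecord_of_rows : F0P3InnerFormClassificationV8.KitFamily.Laws (kitFamilyOfRecord 𝔇) := by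
  refine lawsV8_kitFamilyOfRecord_of 𝔇 fun L _ _ _ ι H T hT hdef h2 μ _ μω hμu hμω => ?_
  obtain ⟨S₀, hpk, h1, hTF, h2', h6, h7, h8, h10, h15, hJ, hD, h20, h21, h23⟩ := h L ι H T hT hdef h2 μ μω hμu hμω
  letI : MeasurableSpace (Gp L H).Adelic := borel _
  haveI : BorelSpace (Gp L H).Adelic := ⟨rfl⟩
  haveI := (𝔇 L ι H T hT hdef h2 μ μω hμu hμω).isFiniteMeasureOnCompacts_ν
  exact ⟨S₀, laws₈_kitOfRecord_of₄ L H ι T hT μ _ _ _ μω hμu _ _ _ _ _ _ _ S₀ hdef h2 h1 h2'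
    (F0P3InnerFormClassificationV8.ClassificationKit.factorisation_of_cls_of_pk _ hTF hpk.factorisationPk) hpk.matchingS hpk.transferS h6 h7 h8 h10
    hpk.aPacketSpectral hpk.localExpansion (routing₈_kitOfRecord_of_v6 L H ι T hT μ _ _ _ μω _ _ _ _ _ _ _ h15) hμω hJ hD h20 h21 h23⟩

include h in
/-- **MEM AT THE ROWS, for every `ξ`.**  For a family `𝔇` of per-frame `FrameData` with the fourteen rows: at every letters' frame, for every irreducible smooth `σ`,
every cotangent discrete `P` with `P.HasFinComponent σ`, EVERY `ξ` with `MemXiFamily P … ξ`, every finite `v` and every class `c` of `U(H)(L⁺_v)` occurring in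
`σ ∘ inclPlace v`: `c ∈ ((kitFamilyOfRecord 𝔇 …).packFin ξ v).members` (= `((𝔇 …).ξd.packFin ξ v).members`, `rfl`) — ★ p839806 `mem_packFin_of_memXiFamily_of_T5` at the
pinned family (★ `isPinned_kitFamilyOfRecord`) with the laws of §1. [cite: Rogawski1990, §14.6 Thm. 14.6.4 p. 244; Thm. 13.3.7; §13.3 p. 201; §15.3 ¶1]
[cite: Zelevinsky1980, Thm. 4.2] [cite: BorelWallach2000, VI Thm. 4.11] -/
theorem mem_packFin_of_rows :
    ∀ (L : Type) [Field L] [NumberField L] [IsCMField L] (ι : L →+* ℂ) (H : Matrix (Fin 3) (Fin 3) L) (T : GL (Fin 3) ℂ)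
      (hT : (T : Matrix (Fin 3) (Fin 3) ℂ)ᴴ * H.map ι * (T : Matrix (Fin 3) (Fin 3) ℂ) = Literature.Geometry.ComplexHyperbolic.BallModel.J)
      (hdef : ∀ τ' : L →+* ℂ, InfinitePlace.mk τ' ≠ InfinitePlace.mk ι → (H.map τ').PosDef)
      (h2 : 2 ≤ Module.finrank ℚ ↥(maximalRealSubfield L))
      (μ : Measure (adelicGroupData (↥(maximalRealSubfield L)) L (IsCMField.complexConj L) 3 H).automorphicQuotient)
      [(adelicGroupData (↥(maximalRealSubfield L)) L (IsCMField.complexConj L) 3 H).IsAutomorphicMeasure μ]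
      (μω : HeckeCharacter L) (hμu : μω.IsUnitary)
      (hμω : ∀ x : Literature.NumberTheory.GaloisRepresentations.ideleGroup ↥(maximalRealSubfield L),
        μω (AdeleRing.ideleBaseChange (↥(maximalRealSubfield L)) L x) = quadraticHeckeCharCM L x)
      (W : Type) [AddCommGroup W] [Module ℂ W]
      (σ : Representation ℂ (finAdelic (↥(maximalRealSubfield L)) L (IsCMField.complexConj L) 3 H) W),
      σ.IsIrreducible → σ.IsSmooth →
      ∀ (P : DiscreteAutomorphicRep (adelicGroupData (↥(maximalRealSubfield L)) L (IsCMField.complexConj L) 3 H) μ),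
        (P.IsHolCotangentAt (cmArchSection L ι H T hT) (cmCompactFactor L ι H T hT) ∨
          P.IsAntiholCotangentAt (cmArchSection L ι H T hT) (cmCompactFactor L ι H T hT)) →
        P.HasFinComponent σ →
      ∀ (ξ : OneDimAutRepH L),
        MemXiFamily P (transpose_map_cmConjRingHom_eq_of_frame L ι H T hT) (isUnit_det_of_frame L ι H T hT) μω hμu ξ →
      ∀ (v : HeightOneSpectrum (𝓞 ↥(maximalRealSubfield L))) (c : IrrClass ((cmDatum L 3 H).Local v)),
        (IrrClass.comap (localPiEquiv L (IsCMField.complexConj L) 3 H v) c).IsConstituentOf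
            (σ.comp (inclPlace (↥(maximalRealSubfield L)) L (IsCMField.complexConj L) 3 H v)) →
        c ∈ ((kitFamilyOfRecord 𝔇 L ι H T hT hdef h2 μ μω hμu hμω).packFin ξ v).members :=
  F0P2oD7alphaMemOfT5.mem_packFin_of_memXiFamily_of_T5 (kitFamilyOfRecord 𝔇) (isPinned_kitFamilyOfRecord 𝔇)
    (lawsV8_kitFamilyOfRecord_of_rows 𝔇 h)

end Rows


/-! ## §2 THE HEAD — the per-measure D7α node BY NAME from the rows and the record data (SPEC §1 H₁–H₈; H₃–H₈ bundled per frame in `hrec`) -/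

section PerMeasure

variable
  (𝔇 : ∀ (L : Type) [Field L] [NumberField L] [IsCMField L] (ι : L →+* ℂ) (H : Matrix (Fin 3) (Fin 3) L) (T : GL (Fin 3) ℂ)
    (hT : (T : Matrix (Fin 3) (Fin 3) ℂ)ᴴ * H.map ι * (T : Matrix (Fin 3) (Fin 3) ℂ) = Literature.Geometry.ComplexHyperbolic.BallModel.J),
    (∀ τ' : L →+* ℂ, InfinitePlace.mk τ' ≠ InfinitePlace.mk ι → (H.map τ').PosDef) →
    2 ≤ Module.finrank ℚ ↥(maximalRealSubfield L) →
    ∀ (μ : Measure (Gp L H).automorphicQuotient) [(Gp L H).IsAutomorphicMeasure μ] (μω : HeckeCharacter L) (_hμu : μω.IsUnitary),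
    (∀ x : Literature.NumberTheory.GaloisRepresentations.ideleGroup ↥(maximalRealSubfield L),
      μω (AdeleRing.ideleBaseChange (↥(maximalRealSubfield L)) L x) = quadraticHeckeCharCM L x) → FrameData L H ι T hT μ)
  (h : ∀ (L : Type) [Field L] [NumberField L] [IsCMField L] (ι : L →+* ℂ) (H : Matrix (Fin 3) (Fin 3) L) (T : GL (Fin 3) ℂ)
    (hT : (T : Matrix (Fin 3) (Fin 3) ℂ)ᴴ * H.map ι * (T : Matrix (Fin 3) (Fin 3) ℂ) = Literature.Geometry.ComplexHyperbolic.BallModel.J)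
    (hdef : ∀ τ' : L →+* ℂ, InfinitePlace.mk τ' ≠ InfinitePlace.mk ι → (H.map τ').PosDef) (h2 : 2 ≤ Module.finrank ℚ ↥(maximalRealSubfield L))
    (μ : Measure (Gp L H).automorphicQuotient) [(Gp L H).IsAutomorphicMeasure μ] (μω : HeckeCharacter L) (hμu : μω.IsUnitary)
    (hμω : ∀ x : Literature.NumberTheory.GaloisRepresentations.ideleGroup ↥(maximalRealSubfield L),
      μω (AdeleRing.ideleBaseChange (↥(maximalRealSubfield L)) L x) = quadraticHeckeCharCM L x),
    ∃ S₀ : Finset (Places L),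
    F0P3InnerFormClassificationV8.ClassificationKit.SpecPkg (kitFamilyOfRecord 𝔇 L ι H T hT hdef h2 μ μω hμu hμω) S₀ ∧
    (kitFamilyOfRecord 𝔇 L ι H T hT hdef h2 μ μω hμu hμω).TraceIdentity ∧
    F0P3InnerFormClassificationV8.ClassificationKit.FactorisationCls (kitFamilyOfRecord 𝔇 L ι H T hT hdef h2 μ μω hμu hμω) S₀ ∧
    (kitFamilyOfRecord 𝔇 L ι H T hT hdef h2 μ μω hμu hμω).SpectralSideGp ∧
    F0P3InnerFormClassificationV8.ClassificationKit.HatBounded (kitFamilyOfRecord 𝔇 L ι H T hT hdef h2 μ μω hμu hμω) S₀ ∧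
    F0P3InnerFormClassificationV8.ClassificationKit.UnrStarAlgebra (kitFamilyOfRecord 𝔇 L ι H T hT hdef h2 μ μω hμu hμω) S₀ ∧
    (kitFamilyOfRecord 𝔇 L ι H T hT hdef h2 μ μω hμu hμω).LinIndepS ∧
    F0P3InnerFormClassificationV8.ClassificationKit.UnitaryPacket (kitFamilyOfRecord 𝔇 L ι H T hT hdef h2 μ μω hμu hμω) S₀ ∧
    (kitFamilyOfRecord 𝔇 L ι H T hT hdef h2 μ μω hμu hμω).Routing ∧
    JInfNoDegOne (𝔇 L ι H T hT hdef h2 μ μω hμu hμω).jInf ∧ DsInfNoDegOne (𝔇 L ι H T hT hdef h2 μ μω hμu hμω).dsInf ∧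
    (kitFamilyOfRecord 𝔇 L ι H T hT hdef h2 μ μω hμu hμω).XiFamilyFin μω hμu ∧
    (kitFamilyOfRecord 𝔇 L ι H T hT hdef h2 μ μω hμu hμω).XiUnram ∧
    (kitFamilyOfRecord 𝔇 L ι H T hT hdef h2 μ μω hμu hμω).EvpConvention)

include h in
/-- **`StubD7αMemDockPerMeasure` FROM THE ROWS AND THE RECORD DATA (assembly only).**  Hypotheses: H₁ `𝔇` (a family of per-frame `FrameData`), H₂ `h` (its fourteen
rows, the hypothesis of ★ `letters_of_specPkgV8` VERBATIM), and — bundled per frame AND per measure into ONE hypothesis `hrec`, because H₄–H₈ speak about H₃'s data —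
H₃ record data `(Δ, mH, mG, νG, νH, μZ, keys, hCM)` (the ∃-binders of the node, `ξloc := fun ξ v => ξ.xiLocalChar v` BY NAME), H₄ `(kitFamilyOfRecord 𝔇 …).packFin =
xiPacketFamilyOfRecord … Δ mH mG νG νH (·.xiLocalChar) μZ keys hCM` (`rfl` at the closer's `frameDataOfRung0`), H₅ `μZ v` Haar, H₆ `νG v` Haar, H₇ `φ ↦ φ^H` exists at every
non-split `v` (★ `IsLocalDeltaTransferExists`, the N6 currency; T1's law T1g at the record data), H₈ the print letter (D-b) ★ `GelbartRogawski1991.piSCompletion_isThetaTypeAtCM`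
BY NAME at the same data, every theta frame and every `ξ`.  Conclusion: the D7α node of record ★ `F0P2oD7alphaMemDockStatement.StubD7αMemDockPerMeasure` BY NAME.
Proof: the ∃ is witnessed by H₃'s data; DOCK = ★ `F0P2oCharIdentityCompletionUnique.cmThetaDockingClauses_of_thetaWitness … hex hW` ((D-a) uniqueness of the (13.1.4)-completion
under surjective matching + the theta witness); MEM_μ = §1 `mem_packFin_of_rows` rewritten along H₄.
[cite: Rogawski1990, §13.1 Prop. 13.1.3 (d), Prop. 13.1.4 p. 199; Thm. 13.3.7; §14.6 Thm. 14.6.4 pp. 244–246; §4.9 Prop. 4.9.1 (a) p. 55]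
[cite: GelbartRogawski1991, Lem. 5.1.2 p. 466; Thm. 5.1.1 p. 465] [cite: Zelevinsky1980, Thm. 4.2] -/
theorem stubD7αMemDockPerMeasure_of_rows
  (hrec : ∀ (L : Type) [Field L] [NumberField L] [IsCMField L] (ι : L →+* ℂ) (H : Matrix (Fin 3) (Fin 3) L) (T : GL (Fin 3) ℂ)
    (hT : (T : Matrix (Fin 3) (Fin 3) ℂ)ᴴ * H.map ι * (T : Matrix (Fin 3) (Fin 3) ℂ) = Literature.Geometry.ComplexHyperbolic.BallModel.J)
    (hdef : ∀ τ' : L →+* ℂ, InfinitePlace.mk τ' ≠ InfinitePlace.mk ι → (H.map τ').PosDef) (h2 : 2 ≤ Module.finrank ℚ ↥(maximalRealSubfield L))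
    (μω : HeckeCharacter L) (hμu : μω.IsUnitary)
    (hμω : ∀ x : Literature.NumberTheory.GaloisRepresentations.ideleGroup ↥(maximalRealSubfield L), μω (AdeleRing.ideleBaseChange (↥(maximalRealSubfield L)) L x) = quadraticHeckeCharCM L x)
    (μ : Measure (adelicGroupData (↥(maximalRealSubfield L)) L (IsCMField.complexConj L) 3 H).automorphicQuotient) [(adelicGroupData (↥(maximalRealSubfield L)) L (IsCMField.complexConj L) 3 H).IsAutomorphicMeasure μ],
    letI : ∀ v : HeightOneSpectrum (𝓞 ↥(maximalRealSubfield L)), MeasurableSpace ((cmDatum L 3 H).Local v) := fun _ => borel _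
    letI : ∀ v : HeightOneSpectrum (𝓞 ↥(maximalRealSubfield L)),
        MeasurableSpace ((cmDatum L 2 (Matrix.of fun i j : Fin 2 => if i.val + j.val + 1 = 2 then (1 : L) else 0)).Local v ×
          (cmDatum L 1 (Matrix.of fun i j : Fin 1 => if i.val + j.val + 1 = 1 then (1 : L) else 0)).Local v) := fun _ => borel _
    letI : ∀ (v : HeightOneSpectrum (𝓞 ↥(maximalRealSubfield L)))
        (a : ((cmDatum L 2 (Matrix.of fun i j : Fin 2 => if i.val + j.val + 1 = 2 then (1 : L) else 0)).Local v ×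
          (cmDatum L 1 (Matrix.of fun i j : Fin 1 => if i.val + j.val + 1 = 1 then (1 : L) else 0)).Local v)),
        MeasurableSpace (((cmDatum L 2 (Matrix.of fun i j : Fin 2 => if i.val + j.val + 1 = 2 then (1 : L) else 0)).Local v ×
            (cmDatum L 1 (Matrix.of fun i j : Fin 1 => if i.val + j.val + 1 = 1 then (1 : L) else 0)).Local v) ⧸
          Subgroup.centralizer ({a} : Set ((cmDatum L 2 (Matrix.of fun i j : Fin 2 => if i.val + j.val + 1 = 2 then (1 : L) else 0)).Local v ×
            (cmDatum L 1 (Matrix.of fun i j : Fin 1 => if i.val + j.val + 1 = 1 then (1 : L) else 0)).Local v))) := fun _ _ => borel _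
    letI : ∀ (v : HeightOneSpectrum (𝓞 ↥(maximalRealSubfield L))) (γ : (cmDatum L 3 H).Local v),
        MeasurableSpace ((cmDatum L 3 H).Local v ⧸ Subgroup.centralizer ({γ} : Set ((cmDatum L 3 H).Local v))) := fun _ _ => borel _
    letI : ∀ v : HeightOneSpectrum (𝓞 ↥(maximalRealSubfield L)), MeasurableSpace (Gqs L v ⧸ Subgroup.center (Gqs L v)) := fun _ => borel _
    ∃ (Δ : ∀ v : HeightOneSpectrum (𝓞 ↥(maximalRealSubfield L)), LocalTransferFactor L H v)
      (mH : ∀ v : HeightOneSpectrum (𝓞 ↥(maximalRealSubfield L)),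
    OrbitalMeasureFamily ((cmDatum L 2 (Matrix.of fun i j : Fin 2 => if i.val + j.val + 1 = 2 then (1 : L) else 0)).Local v ×
      (cmDatum L 1 (Matrix.of fun i j : Fin 1 => if i.val + j.val + 1 = 1 then (1 : L) else 0)).Local v))
      (mG : ∀ v : HeightOneSpectrum (𝓞 ↥(maximalRealSubfield L)), OrbitalMeasureFamily ((cmDatum L 3 H).Local v))
      (νG : ∀ v : HeightOneSpectrum (𝓞 ↥(maximalRealSubfield L)), Measure ((cmDatum L 3 H).Local v))
      (νH : ∀ v : HeightOneSpectrum (𝓞 ↥(maximalRealSubfield L)),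
    Measure ((cmDatum L 2 (Matrix.of fun i j : Fin 2 => if i.val + j.val + 1 = 2 then (1 : L) else 0)).Local v ×
      (cmDatum L 1 (Matrix.of fun i j : Fin 1 => if i.val + j.val + 1 = 1 then (1 : L) else 0)).Local v))
      (μZ : ∀ v : HeightOneSpectrum (𝓞 ↥(maximalRealSubfield L)), Measure (Gqs L v ⧸ Subgroup.center (Gqs L v)))
      (keys : ∀ (ξ : OneDimAutRepH L) (v : HeightOneSpectrum (𝓞 ↥(maximalRealSubfield L))),
    (∀ w : PlacesOver L v, IsCMField.complexConj L • w.1 = w.1) →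
      {p : IrrClass (Gqs L v) × IrrClass (Gqs L v) //
        KeysCaseTwoLabels L v (μω.semilocalComponent L v) (torusLocalComponent L (IsCMField.complexConj L) v ξ.η)
          (torusLocalComponent L (IsCMField.complexConj L) v ξ.ψ) p.1 p.2 ∧
        p.1.IsSquareIntegrable (μZ v) ∧ ¬ p.2.IsSquareIntegrable (μZ v)})
      (hCM : ∀ (ξ : OneDimAutRepH L) (v : HeightOneSpectrum (𝓞 ↥(maximalRealSubfield L)))
    (hns : ∀ w : PlacesOver L v, IsCMField.complexConj L • w.1 = w.1)
    (T : GL (Fin 3) (LocalRing L v)) (a : LocalRing L v) (ha : IsUnit a)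
    (h : formCongr (conjLocal L (IsCMField.complexConj L) v) T (H.map (algebraMap L (LocalRing L v))) =
      a • (Matrix.of fun i j : Fin 3 => if i.val + j.val + 1 = 3 then (1 : L) else 0).map (algebraMap L (LocalRing L v)))
    (π2 πn : IrrClass (Gqs L v)),
    KeysCaseTwoLabels L v (μω.semilocalComponent L v) (torusLocalComponent L (IsCMField.complexConj L) v ξ.η)
      (torusLocalComponent L (IsCMField.complexConj L) v ξ.ψ) π2 πn → ¬ πn.IsSquareIntegrable (μZ v) →
    CMNonsplitCharIdentityAt L v H (Δ v) (mH v) (mG v) (νG v) (νH v) (ξ.xiLocalChar v) (IrrClass.comap (cmDatumLocalCongr L v T ha h).symm πn)),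
      -- (H₄) the kit family's finite A-packets ARE the packet family OF RECORD at these data (`rfl` at the closer's `frameDataOfRung0`)
      (kitFamilyOfRecord 𝔇 L ι H T hT hdef h2 μ μω hμu hμω).packFin =
          F0P3XiPacketFamilyOfRecord.xiPacketFamilyOfRecord L H (transpose_map_cmConjRingHom_eq_of_frame L ι H T hT) (isUnit_det_of_frame L ι H T hT) μω hμu
            Δ mH mG νG νH (fun (ξ : OneDimAutRepH L) v => ξ.xiLocalChar v) μZ keys hCM ∧
      -- (H₅) (H₆) Haar measures: `μZ v` (the node's own `_hHaar`) and `νG v` (the (D-a) junction's instance binder)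
      (∀ v : HeightOneSpectrum (𝓞 ↥(maximalRealSubfield L)), (μZ v).IsHaarMeasure) ∧
      (∀ v : HeightOneSpectrum (𝓞 ↥(maximalRealSubfield L)), (νG v).IsHaarMeasure) ∧
      -- (H₇) `φ ↦ φ^H` exists on `C_c^∞` at every non-split finite place [Rogawski1990 Prop. 4.9.1 (a)] (the N6 #102 currency)
      (∀ v : HeightOneSpectrum (𝓞 ↥(maximalRealSubfield L)), (∀ w : PlacesOver L v, IsCMField.complexConj L • w.1 = w.1) →
        IsLocalDeltaTransferExists L H v (Δ v) (mH v) (mG v) Literature.NumberTheory.Rogawski1990.IsLocSmooth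
          Literature.NumberTheory.Rogawski1990.IsLocSmooth) ∧
      -- (H₈) the print letter (D-b) BY NAME at these data [GelbartRogawski1991 Lem. 5.1.2, Thm. 5.1.1; Rogawski1992 Thm. 1.1]
      (∀ {n' : ℕ} (e₁ : Fin 3 × Fin 1 ≃ Fin n') (dV : Fin 3 → L) (hdV : ∀ i, IsCMField.complexConj L (dV i) = dV i) (hdV0 : ∀ i, dV i ≠ 0) (g : GL (Fin 3) L)
          (hg : ((g : Matrix (Fin 3) (Fin 3) L).map (cmConjRingHom L))ᵀ * H * (g : Matrix (Fin 3) (Fin 3) L) = Matrix.diagonal dV) (ξ : OneDimAutRepH L),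
        Literature.NumberTheory.GelbartRogawski1991.piSCompletion_isThetaTypeAtCM L H Δ mH mG νH νG ξ μω (fun v => ξ.xiLocalChar v) e₁ dV hdV hdV0 g hg)) :
    F0P2oD7alphaMemDockStatement.StubD7αMemDockPerMeasure := by
  intro L _ _ _ ι H T hT hdef h2 μω hμu hμω μ _
  obtain ⟨Δ, mH, mG, νG, νH, μZ, keys, hCM, hpack, hHaar, hνG, hex, hW⟩ := hrec L ι H T hT hdef h2 μω hμu hμω μ
  refine ⟨Δ, mH, mG, νG, νH, fun ξ v => ξ.xiLocalChar v, μZ, keys, hCM, hHaar, ?_, ?_⟩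
  · -- DOCK at the record data: (D-a) junction fed H₇ and the letter (D-b) H₈ (borel σ-algebras as in the node's `letI`s)
    intro n' e₁ dV hdV hdV0 g hg ξ
    letI : ∀ v : HeightOneSpectrum (𝓞 ↥(maximalRealSubfield L)), MeasurableSpace ((cmDatum L 3 H).Local v) := fun _ => borel _
    letI : ∀ v : HeightOneSpectrum (𝓞 ↥(maximalRealSubfield L)),
        MeasurableSpace ((cmDatum L 2 (Matrix.of fun i j : Fin 2 => if i.val + j.val + 1 = 2 then (1 : L) else 0)).Local v ×
          (cmDatum L 1 (Matrix.of fun i j : Fin 1 => if i.val + j.val + 1 = 1 then (1 : L) else 0)).Local v) := fun _ => borel _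
    letI : ∀ (v : HeightOneSpectrum (𝓞 ↥(maximalRealSubfield L)))
        (a : ((cmDatum L 2 (Matrix.of fun i j : Fin 2 => if i.val + j.val + 1 = 2 then (1 : L) else 0)).Local v ×
          (cmDatum L 1 (Matrix.of fun i j : Fin 1 => if i.val + j.val + 1 = 1 then (1 : L) else 0)).Local v)),
        MeasurableSpace (((cmDatum L 2 (Matrix.of fun i j : Fin 2 => if i.val + j.val + 1 = 2 then (1 : L) else 0)).Local v ×
            (cmDatum L 1 (Matrix.of fun i j : Fin 1 => if i.val + j.val + 1 = 1 then (1 : L) else 0)).Local v) ⧸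
          Subgroup.centralizer ({a} : Set ((cmDatum L 2 (Matrix.of fun i j : Fin 2 => if i.val + j.val + 1 = 2 then (1 : L) else 0)).Local v ×
            (cmDatum L 1 (Matrix.of fun i j : Fin 1 => if i.val + j.val + 1 = 1 then (1 : L) else 0)).Local v))) := fun _ _ => borel _
    letI : ∀ (v : HeightOneSpectrum (𝓞 ↥(maximalRealSubfield L))) (γ : (cmDatum L 3 H).Local v),
        MeasurableSpace ((cmDatum L 3 H).Local v ⧸ Subgroup.centralizer ({γ} : Set ((cmDatum L 3 H).Local v))) := fun _ _ => borel _
    haveI : ∀ v : HeightOneSpectrum (𝓞 ↥(maximalRealSubfield L)), BorelSpace ((cmDatum L 3 H).Local v) := fun _ => ⟨rfl⟩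
    haveI : ∀ v : HeightOneSpectrum (𝓞 ↥(maximalRealSubfield L)), (νG v).IsHaarMeasure := hνG
    exact F0P2oCharIdentityCompletionUnique.cmThetaDockingClauses_of_thetaWitness L H (transpose_map_cmConjRingHom_eq_of_frame L ι H T hT)
      (isUnit_det_of_frame L ι H T hT) Δ mH mG νH νG ξ μω (fun v => ξ.xiLocalChar v) e₁ dV hdV hdV0 g hg hex (hW e₁ dV hdV hdV0 g hg ξ)
  · -- MEM_μ at the record data: §1 at the rows, read through H₄
    intro W _ _ σ hirr hsm _hadm P hP hPσ ξ hmem v _hns c hc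
    have hm := mem_packFin_of_rows 𝔇 h L ι H T hT hdef h2 μ μω hμu hμω W σ hirr hsm P hP hPσ ξ hmem v c hc
    rw [hpack] at hm
    exact hm

end PerMeasure

end Summit.HodgeConjecture.HodgeConjecture.Cruxes.H413.F0P2oD7alphaMemDockOfRows

end
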